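import Literature.AlgebraicGeometry.Resolution.AlterationsStrictTransformModel
import Literature.AlgebraicGeometry.Resolution.FibreComponentsBaseChange
import Literature.AlgebraicGeometry.Resolution.SmoothLocusBaseChange
import Literature.AlgebraicGeometry.Resolution.AlterationsMultisectionLocalStepProofs
import Literature.AlgebraicGeometry.Resolution.LiuFlatIntegral
import Literature.AlgebraicGeometry.Resolution.SmoothStalksRegular
import Literature.AlgebraicGeometry.Resolution.BaseChangeOverOpens
import Literature.AlgebraicGeometry.Motives.GoodReductionSpecialFibreProofs
import HarnessLib

/-!
# De Jong's alteration theorem, 4.15: the strict transform `(Y' ×_Y X)_red` — (vi) a)–c) and `φ`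

Topic: `Literature/AlgebraicGeometry/Resolution`. Proofs towards the discharge of the named fact
`DeJong1996StrictTransform` (`AlterationsStrictTransform.lean`; de Jong 1996, 4.15):

> "Here `X'` is the reduction of the scheme `Y' ×_Y X` […]. It is easy to see that the morphism
> `f'` satisfies (vi) a)–c); from this we conclude that `X'` is irreducible. Thus `φ : X' → X`
> is a projective alteration which is generically étale." (p. 71)

As in the named fact, the reduction `X'` enters through its characterisation: a surjective
closed immersion `ι : X' → X ×_Y Y'` (Mathlib `pullback f ψ`) from a reduced scheme;
`f' = ι ≫ pr_{Y'}`, `φ = ι ≫ pr_X`. Everything here is PROVED, for such an `ι`: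

* `isReduced_preimage_smoothLocus` — `X ×_Y Y'` is reduced over `pr_X⁻¹(sm(X/Y))`: there
  `pr_{Y'}` is smooth (`Scheme.Hom.preimage_smoothLocus_le_smoothLocus_pullback_snd`), hence flat
  with reduced generic fibre over the integral `Y'` (Liu 2002, 4.3.8,
  `isReduced_of_flat_of_isReduced_fiber_genericPoint`); `isReduced_preimage_of_etale` —
  `X ×_Y Y'` is reduced over `pr_{Y'}⁻¹(V')` if `V' → Y` is étale (étale over the integral `X`);
  so `ι` is an isomorphism over both opens (`isIso_morphismRestrict_of_isClosedImmersion_of_surjective`);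
* **`φ` is an alteration, generically étale if `ψ` is** (`isAlteration_comp_fst`,
  `isGenericallyEtale_comp_fst`): proper and surjective; finite over `f⁻¹(U)` if `ψ` is finite
  over `U`; étale on `f'⁻¹(V')`, a non-empty open of the irreducible `X'`, if `ψ` is étale on
  `V'`;
* **(vi) a)–c) for `f'`**: the fibres of `f'` map by a surjective closed immersion, a
  homeomorphism, onto the fibres of `pr_{Y'}` (`exists_fibreComparison`), which are base changes
  of the fibres of `f` to larger residue fields; hence `f'` is surjective with geometrically
  connected fibres (`geometricallyConnected_comp_snd`), every irreducible component of every
  fibre has dimension `1` (`topologicalKrullDim_fiber_comp_snd`, by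
  `topologicalKrullDim_fiber_of_isPullback`), the smooth locus of `f'` contains `ι⁻¹(pr_X⁻¹(sm(X/Y)))`
  (`preimage_preimage_smoothLocus_le`) and is dense in every fibre (`dense_preimage_smoothLocus_comp_snd`:
  the projection of a fibre of `pr_{Y'}` onto a fibre of `f` is open, being a base change of a
  morphism of spectra of fields), and the generic fibre of `f'` is smooth
  (`smooth_fiberToSpecResidueField_genericPoint_comp_snd`: the generic fibre of `pr_{Y'}` is
  smooth, hence reduced, so the comparison map is an isomorphism there).

The remaining parts of 4.15 (irreducibility of `X'`, (iii), (iv), (vi) d), (vi) e)) and the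
assembly `DeJong1996StrictTransform_holds` follow in a companion file.

## Sources

* A. J. de Jong, *Smoothness, semi-stability and alterations*, Publ. Math. IHÉS 83 (1996) 51–93:
  2.20 (p. 61), 4.15 (p. 71).
* Q. Liu, *Algebraic Geometry and Arithmetic Curves* (2002), Prop. 4.3.8.
-/

noncomputable section

open CategoryTheory CategoryTheory.Limits AlgebraicGeometry TopologicalSpace Topology

namespace Literature.AlgebraicGeometry.Resolution

universe u

namespace DeJong1996.StrictTransform

variable {X Y Y' X' : Scheme.{u}} (f : X ⟶ Y) (ψ : Y' ⟶ Y) (ι : X' ⟶ pullback f ψ)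

/-! ## Reducedness of `X ×_Y Y'` over the smooth locus of `f` and over the étale locus of `ψ` -/

/-- Over `pr_X⁻¹(sm(X/Y))` the projection `X ×_Y Y' → Y'` is smooth. [folklore] -/
theorem smooth_ι_preimage_smoothLocus_comp_snd [LocallyOfFinitePresentation f] :
    Smooth ((pullback.fst f ψ ⁻¹ᵁ f.smoothLocus).ι ≫ pullback.snd f ψ) := by
  rw [← Scheme.Hom.smoothLocus_eq_top_iff, ← Scheme.Hom.preimage_smoothLocus_eq]
  apply top_le_iff.mp
  rintro ⟨p, hp⟩ -
  exact Scheme.Hom.preimage_smoothLocus_le_smoothLocus_pullback_snd f ψ hp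

/-- **`X ×_Y Y'` is reduced over `pr_X⁻¹(sm(X/Y))`** when `Y'` is integral: there the projection to
`Y'` is smooth, hence flat with smooth — so reduced — generic fibre, and Liu 2002, Prop. 4.3.8
applies (`isReduced_of_flat_of_isReduced_fiber_genericPoint`). [cite: Liu2002, Prop. 4.3.8] -/
theorem isReduced_preimage_smoothLocus [LocallyOfFinitePresentation f] [IsIntegral Y'] :
    IsReduced (pullback.fst f ψ ⁻¹ᵁ f.smoothLocus : Scheme.{u}) := by
  set g := (pullback.fst f ψ ⁻¹ᵁ f.smoothLocus).ι ≫ pullback.snd f ψ with hg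
  haveI : Smooth g := smooth_ι_preimage_smoothLocus_comp_snd f ψ
  haveI : IsReduced (g.fiber (genericPoint Y')) := by
    haveI : Smooth (g.fiberToSpecResidueField (genericPoint Y')) :=
      MorphismProperty.pullback_snd _ _ inferInstance
    exact isReduced_of_smooth (K := Y'.residueField (genericPoint Y'))
      (g.fiberToSpecResidueField (genericPoint Y'))
  exact isReduced_of_flat_of_isReduced_fiber_genericPoint g

/-- **`X ×_Y Y'` is reduced over `pr_{Y'}⁻¹(V')` if `V' → Y` is étale** and `X` is integral: there
the projection to `X` is étale (a base change of `V' → Y`), and a scheme étale over an integral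
scheme is reduced (`isReduced_of_etale_of_isIntegral`). [folklore] -/
theorem isReduced_preimage_of_etale [IsIntegral X] (V' : Y'.Opens) [Etale (V'.ι ≫ ψ)] :
    IsReduced (pullback.snd f ψ ⁻¹ᵁ V' : Scheme.{u}) := by
  haveI : Etale ((pullback.snd f ψ ⁻¹ᵁ V').ι ≫ pullback.fst f ψ) :=
    ι_comp_pullback_fst_of_ι_comp (P := @Etale) f ψ V' inferInstance
  exact isReduced_of_etale_of_isIntegral ((pullback.snd f ψ ⁻¹ᵁ V').ι ≫ pullback.fst f ψ)

/-! ## `φ = ι ≫ pr_X` is an alteration, generically étale if `ψ` is -/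

variable [IsClosedImmersion ι] [Surjective ι]

omit [Surjective ι] in
/-- `φ` is finite over `f⁻¹(U)` if `ψ` is finite over `U`. [folklore] -/
theorem isFinite_morphismRestrict_comp_fst (U : Y.Opens) [IsFinite (ψ ∣_ U)] :
    IsFinite ((ι ≫ pullback.fst f ψ) ∣_ (f ⁻¹ᵁ U)) := by
  haveI : IsFinite (pullback.fst f ψ ∣_ (f ⁻¹ᵁ U)) :=
    morphismRestrict_pullback_fst_of_morphismRestrict (P := @IsFinite) f ψ U inferInstance
  have : IsFinite (ι ∣_ (pullback.fst f ψ ⁻¹ᵁ (f ⁻¹ᵁ U)) ≫ pullback.fst f ψ ∣_ (f ⁻¹ᵁ U)) :=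
    inferInstance
  rw [← morphismRestrict_comp] at this
  exact this

/-- **`φ : X' → X` is an alteration** (de Jong 1996, 4.15: "Thus `φ : X' → X` is a projective
alteration"; 2.20): `X'` integral (hypothesis), `φ` proper (a closed immersion followed by a base
change of the proper `ψ`), dominant (even surjective), and finite over the non-empty open
`f⁻¹(U)` if `ψ` is finite over the non-empty `U`. [cite: DeJong1996, 2.20 and 4.15, pp. 61, 71] -/
theorem isAlteration_comp_fst [IsIntegral X'] [Surjective f] (hψ : IsAlteration ψ) :
    IsAlteration (ι ≫ pullback.fst f ψ) := by
  haveI := hψ.isProper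
  haveI : Surjective ψ := hψ.surjective
  obtain ⟨U, hU, hfin⟩ := hψ.exists_isFinite
  haveI := hfin
  haveI : Surjective (ι ≫ pullback.fst f ψ) := inferInstance
  refine ⟨inferInstance, inferInstance, ⟨(ι ≫ pullback.fst f ψ).surjective.denseRange⟩,
    f ⁻¹ᵁ U, ?_, isFinite_morphismRestrict_comp_fst f ψ ι U⟩
  obtain ⟨y, hy⟩ := hU
  obtain ⟨x, rfl⟩ := f.surjective y
  exact ⟨x, hy⟩

/-- `φ` is étale on `f'⁻¹(V') = ι⁻¹(pr_{Y'}⁻¹(V'))` if `ψ` is étale on `V'` (and `X` is integral):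
over `pr_{Y'}⁻¹(V')` the fibre product is reduced, so `ι` is an isomorphism there, and the
projection to `X` is étale there. [folklore] -/
theorem etale_ι_comp_comp_fst [IsIntegral X] (V' : Y'.Opens) [Etale (V'.ι ≫ ψ)] :
    Etale ((ι ⁻¹ᵁ (pullback.snd f ψ ⁻¹ᵁ V')).ι ≫ ι ≫ pullback.fst f ψ) := by
  haveI := isReduced_preimage_of_etale f ψ V'
  haveI : IsIso (ι ∣_ (pullback.snd f ψ ⁻¹ᵁ V')) :=
    isIso_morphismRestrict_of_isClosedImmersion_of_surjective ι _
  haveI : Etale ((pullback.snd f ψ ⁻¹ᵁ V').ι ≫ pullback.fst f ψ) :=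
    ι_comp_pullback_fst_of_ι_comp (P := @Etale) f ψ V' inferInstance
  have e : (ι ⁻¹ᵁ (pullback.snd f ψ ⁻¹ᵁ V')).ι ≫ ι ≫ pullback.fst f ψ =
      (ι ∣_ (pullback.snd f ψ ⁻¹ᵁ V')) ≫ (pullback.snd f ψ ⁻¹ᵁ V').ι ≫ pullback.fst f ψ := by
    rw [morphismRestrict_ι_assoc]
  rw [e]
  infer_instance

/-- **`φ : X' → X` is generically étale if `ψ` is** (de Jong 1996, 4.15: "which is generically
étale"): if `ψ` is étale on the dense open `V' ⊆ Y'`, then `φ` is étale on `f'⁻¹(V')`, a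
non-empty — `f'` is onto — hence dense open of the irreducible `X'`.
[cite: DeJong1996, 4.15, p. 71] -/
theorem isGenericallyEtale_comp_fst [IsIntegral X] [IrreducibleSpace X'] [Surjective f]
    [Nonempty Y'] (hψ : IsGenericallyEtale ψ) : IsGenericallyEtale (ι ≫ pullback.fst f ψ) := by
  obtain ⟨V', hV', hV'et⟩ := hψ
  haveI := hV'et
  refine ⟨ι ⁻¹ᵁ (pullback.snd f ψ ⁻¹ᵁ V'), ?_, etale_ι_comp_comp_fst f ψ ι V'⟩
  -- non-empty: `V'` is non-empty and `f' = ι ≫ pr_{Y'}` is onto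
  apply (ι ⁻¹ᵁ (pullback.snd f ψ ⁻¹ᵁ V')).isOpen.dense
  obtain ⟨v, hv⟩ := hV'.nonempty
  haveI : Surjective (ι ≫ pullback.snd f ψ) := inferInstance
  obtain ⟨x, hx⟩ := (ι ≫ pullback.snd f ψ).surjective v
  refine ⟨x, ?_⟩
  show pullback.snd f ψ (ι x) ∈ V'
  rw [← Scheme.Hom.comp_apply, hx]
  exact hv

/-! ## The fibres of `f' = ι ≫ pr_{Y'}` versus the fibres of `pr_{Y'}` -/

omit [Surjective ι] in
/-- **Comparison of fibres.** For `y : T → Y'`, the canonical morphism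
`X' ×_{Y'} T → (X ×_Y Y') ×_{Y'} T` is a base change of `ι`, hence a closed immersion, surjective
if `ι` is, compatible with the two projections. [folklore] -/
theorem exists_fibreComparison {T : Scheme.{u}} (y : T ⟶ Y') :
    ∃ c : pullback (ι ≫ pullback.snd f ψ) y ⟶ pullback (pullback.snd f ψ) y,
      IsClosedImmersion c ∧ (Surjective ι → Surjective c) ∧
        c ≫ pullback.snd (pullback.snd f ψ) y = pullback.snd (ι ≫ pullback.snd f ψ) y ∧
          c ≫ pullback.fst (pullback.snd f ψ) y = pullback.fst (ι ≫ pullback.snd f ψ) y ≫ ι := by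
  refine ⟨(pullbackRightPullbackFstIso (pullback.snd f ψ) y ι).inv ≫
    pullback.snd ι (pullback.fst (pullback.snd f ψ) y), inferInstance, fun _ => inferInstance,
    ?_, ?_⟩
  · rw [Category.assoc, pullbackRightPullbackFstIso_inv_snd_snd]
  · rw [Category.assoc, pullbackRightPullbackFstIso_inv_snd_fst]

/-- A surjective closed immersion is a homeomorphism. [folklore] -/
theorem isHomeomorph_of_isClosedImmersion_of_surjective {A B : Scheme.{u}} (c : A ⟶ B)
    [IsClosedImmersion c] [Surjective c] : IsHomeomorph c :=
  (isHomeomorph_iff_isEmbedding_surjective).mpr ⟨c.isClosedEmbedding.isEmbedding, c.surjective⟩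

/-- **(vi) a), geometric connectedness, for `f'`**: the geometric fibres of `f' = ι ≫ pr_{Y'}` are
homeomorphic to those of `pr_{Y'}`, base changes of the geometrically connected fibres of `f`.
[cite: DeJong1996, 4.15, p. 71] -/
theorem geometricallyConnected_comp_snd [GeometricallyConnected f] :
    GeometricallyConnected (ι ≫ pullback.snd f ψ) := by
  refine ⟨geometrically_iff_of_isClosedUnderIsomorphisms.mpr fun K _ y => ?_⟩
  obtain ⟨c, hc, hcs, -, -⟩ := exists_fibreComparison f ψ ι y
  haveI := hc
  haveI := hcs inferInstance
  haveI : ConnectedSpace ↥(pullback (pullback.snd f ψ) y) :=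
    pullback_of_geometrically
      (GeometricallyConnected.geometrically_connectedSpace (f := pullback.snd f ψ)) K y
  let e := (isHomeomorph_of_isClosedImmersion_of_surjective c).homeomorph
  exact e.symm.surjective.connectedSpace e.symm.continuous

/-- The fibre of `f' = ι ≫ pr_{Y'}` over `y'` is homeomorphic to the fibre of `pr_{Y'}` over `y'`,
compatibly with the inclusions into `X'` and `X ×_Y Y'`. [folklore] -/
theorem exists_fiber_homeomorph (y' : Y') :
    ∃ e : ↥((ι ≫ pullback.snd f ψ).fiber y') ≃ₜ ↥((pullback.snd f ψ).fiber y'),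
      ∀ x, (pullback.snd f ψ).fiberι y' (e x) = ι ((ι ≫ pullback.snd f ψ).fiberι y' x) := by
  obtain ⟨c, hc, hcs, -, hcf⟩ := exists_fibreComparison f ψ ι (Y'.fromSpecResidueField y')
  haveI := hc
  haveI := hcs inferInstance
  refine ⟨(isHomeomorph_of_isClosedImmersion_of_surjective c).homeomorph, fun x => ?_⟩
  change (c ≫ pullback.fst (pullback.snd f ψ) (Y'.fromSpecResidueField y')) x =
    (((ι ≫ pullback.snd f ψ).fiberι y') ≫ ι) x
  rw [hcf]
  rfl

/-- A homeomorphism maps irreducible components to irreducible components of the same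
dimension. [folklore] -/
theorem topologicalKrullDim_image_of_mem_irreducibleComponents {A B : Type*} [TopologicalSpace A]
    [TopologicalSpace B] (e : A ≃ₜ B) {C : Set A} (hC : C ∈ irreducibleComponents A) :
    e '' C ∈ irreducibleComponents B ∧ topologicalKrullDim ↥(e '' C) = topologicalKrullDim ↥C :=
  ⟨image_mem_irreducibleComponents_of_isPreirreducible_fiber e e.continuous e.isOpenMap
      (fun _ => (Set.subsingleton_singleton.preimage e.injective).isPreirreducible) e.surjective hC,
    (IsHomeomorph.topologicalKrullDim_eq (e.image C) (e.image C).isHomeomorph).symm⟩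

/-- **(vi) a), "equidimensional of dimension 1", for `f'`**: every irreducible component of every
fibre of `f' = ι ≫ pr_{Y'}` has dimension `1` if the same holds for `f` (`f` locally of finite
type): the fibres of `f'` are homeomorphic to those of `pr_{Y'}`, whose components have the
dimensions of the components of the fibres of `f` (`topologicalKrullDim_fiber_of_isPullback`).
[cite: DeJong1996, 4.15, p. 71] -/
theorem topologicalKrullDim_fiber_comp_snd [LocallyOfFiniteType f]
    (hf : ∀ (y : Y), ∀ C ∈ irreducibleComponents ↥(f.fiber y), topologicalKrullDim ↥C = 1)
    (y' : Y') :
    ∀ C ∈ irreducibleComponents ↥((ι ≫ pullback.snd f ψ).fiber y'), topologicalKrullDim ↥C = 1 := by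
  intro C hC
  obtain ⟨e, -⟩ := exists_fiber_homeomorph f ψ ι y'
  obtain ⟨hC', hdim⟩ := topologicalKrullDim_image_of_mem_irreducibleComponents e hC
  rw [← hdim]
  exact topologicalKrullDim_fiber_of_isPullback (IsPullback.of_hasPullback f ψ) (d := 1) y'
    (hf (ψ y')) hC'

/-! ## The smooth locus of `f'` -/

/-- **`ι⁻¹(pr_X⁻¹(sm(X/Y))) ⊆ sm(X'/Y')`** (de Jong 1996, 4.15: "`φ⁻¹(sm(X/Y)) ⊂ sm(X'/Y')`"):
over `pr_X⁻¹(sm(X/Y))` the fibre product is reduced, so `ι` is an isomorphism there and `f'` is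
an isomorphism followed by the smooth `pr_X⁻¹(sm(X/Y)) → Y'`. [cite: DeJong1996, 4.15, p. 71] -/
theorem preimage_preimage_smoothLocus_le [LocallyOfFinitePresentation f] [IsIntegral Y']
    [LocallyOfFinitePresentation (ι ≫ pullback.snd f ψ)] :
    ι ⁻¹ᵁ (pullback.fst f ψ ⁻¹ᵁ f.smoothLocus) ≤ (ι ≫ pullback.snd f ψ).smoothLocus := by
  set W := pullback.fst f ψ ⁻¹ᵁ f.smoothLocus with hW
  haveI : IsReduced (W : Scheme.{u}) := isReduced_preimage_smoothLocus f ψ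
  haveI : IsIso (ι ∣_ W) := isIso_morphismRestrict_of_isClosedImmersion_of_surjective ι W
  haveI : Smooth (W.ι ≫ pullback.snd f ψ) := smooth_ι_preimage_smoothLocus_comp_snd f ψ
  have hsm : Smooth ((ι ⁻¹ᵁ W).ι ≫ ι ≫ pullback.snd f ψ) := by
    have e : (ι ⁻¹ᵁ W).ι ≫ ι ≫ pullback.snd f ψ = (ι ∣_ W) ≫ W.ι ≫ pullback.snd f ψ := by
      rw [morphismRestrict_ι_assoc]
    rw [e]
    infer_instance
  intro x hx
  have h : (⟨x, hx⟩ : ↥(ι ⁻¹ᵁ W)) ∈ ((ι ⁻¹ᵁ W).ι ≫ ι ≫ pullback.snd f ψ).smoothLocus := by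
    rw [Scheme.Hom.smoothLocus_eq_top]
    trivial
  rw [← Scheme.Hom.preimage_smoothLocus_eq] at h
  exact h

/-- **(vi) b) for `f'`: the smooth locus of `f'` is dense in every fibre.** In the fibre over `y'`,
the preimage of `ι⁻¹(pr_X⁻¹(sm(X/Y)))` corresponds, under the homeomorphism with the fibre of
`pr_{Y'}`, to the preimage of `(X_{ψ y'} ∩ sm(X/Y))` under the projection
`(X ×_Y Y')_{y'} → X_{ψ y'}`, an OPEN map (a base change of `Spec κ(y') → Spec κ(ψ y')`), so it
is dense; and it lies in the smooth locus of `f'`. [cite: DeJong1996, 4.15, p. 71] -/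
theorem dense_preimage_smoothLocus_comp_snd [LocallyOfFinitePresentation f] [IsIntegral Y']
    [LocallyOfFinitePresentation (ι ≫ pullback.snd f ψ)]
    (hf : ∀ y : Y, Dense ((f.fiberι y) ⁻¹' (f.smoothLocus : Set X))) (y' : Y') :
    Dense (((ι ≫ pullback.snd f ψ).fiberι y') ⁻¹'
      ((ι ≫ pullback.snd f ψ).smoothLocus : Set X')) := by
  set W := pullback.fst f ψ ⁻¹ᵁ f.smoothLocus with hW
  -- it suffices to show that the preimage of `ι⁻¹(W) ⊆ sm(X'/Y')` is dense in the fibre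
  have hsub : ((ι ≫ pullback.snd f ψ).fiberι y') ⁻¹' ((ι ⁻¹ᵁ W : X'.Opens) : Set X') ⊆
      ((ι ≫ pullback.snd f ψ).fiberι y') ⁻¹' ((ι ≫ pullback.snd f ψ).smoothLocus : Set X') :=
    Set.preimage_mono (show ((ι ⁻¹ᵁ W : X'.Opens) : Set X') ⊆ _ from
      preimage_preimage_smoothLocus_le f ψ ι)
  refine Dense.mono hsub ?_
  -- transport to the fibre of `pr_{Y'}` along the homeomorphism of fibres
  obtain ⟨e, he⟩ := exists_fiber_homeomorph f ψ ι y'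
  have heq : ((ι ≫ pullback.snd f ψ).fiberι y') ⁻¹' ((ι ⁻¹ᵁ W : X'.Opens) : Set X') =
      e ⁻¹' (((pullback.snd f ψ).fiberι y') ⁻¹' (W : Set ↥(pullback f ψ))) := by
    ext x
    simp only [Set.mem_preimage, SetLike.mem_coe]
    rw [he]
    rfl
  rw [heq]
  refine Dense.preimage ?_ e.isOpenMap
  -- in the fibre of `pr_{Y'}`: the preimage under the OPEN projection onto the fibre of `f`
  have Hf := isPullback_fiberToSpecResidueField_of_isPullback (IsPullback.of_hasPullback f ψ) y'
  haveI : Subsingleton ↥(Spec (Y.residueField (ψ y'))) :=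
    inferInstanceAs (Subsingleton (PrimeSpectrum (Y.residueField (ψ y'))))
  haveI : UniversallyOpen (Spec.map (ψ.residueFieldMap y')) := inferInstance
  set πf := pullback.map (pullback.snd f ψ) (Y'.fromSpecResidueField y') f
      (Y.fromSpecResidueField (ψ y')) (pullback.fst f ψ) (Spec.map (ψ.residueFieldMap y')) ψ
      (IsPullback.of_hasPullback f ψ).w.symm (by simp) with hπf
  have hopen : IsOpenMap πf := by
    haveI := MorphismProperty.of_isPullback (P := @UniversallyOpen) Hf.flip inferInstance
    exact Scheme.Hom.isOpenMap _
  have hcomm : πf ≫ pullback.fst f (Y.fromSpecResidueField (ψ y')) =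
      pullback.fst (pullback.snd f ψ) (Y'.fromSpecResidueField y') ≫ pullback.fst f ψ := by
    rw [hπf]
    exact pullback.lift_fst _ _ _
  have hπ : (pullback.fst (pullback.snd f ψ) (Y'.fromSpecResidueField y')) ⁻¹'
      (W : Set ↥(pullback f ψ)) =
      πf ⁻¹' ((pullback.fst f (Y.fromSpecResidueField (ψ y'))) ⁻¹' (f.smoothLocus : Set X)) := by
    ext z
    show pullback.fst f ψ (pullback.fst (pullback.snd f ψ) (Y'.fromSpecResidueField y') z) ∈
        f.smoothLocus ↔
      pullback.fst f (Y.fromSpecResidueField (ψ y')) (πf z) ∈ f.smoothLocus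
    rw [← Scheme.Hom.comp_apply, ← Scheme.Hom.comp_apply, hcomm]
  change Dense ((pullback.fst (pullback.snd f ψ) (Y'.fromSpecResidueField y')) ⁻¹'
    (W : Set ↥(pullback f ψ)))
  rw [hπ]
  exact (hf (ψ y')).preimage hopen

/-- **(vi) c) for `f'`: the generic fibre of `f'` is smooth.** The generic fibre of `pr_{Y'}` is
the base change of the smooth generic fibre of `f` (`ψ` is dominant), hence smooth and reduced;
so the comparison closed immersion from the generic fibre of `f'` is an isomorphism.
[cite: DeJong1996, 4.15, p. 71] -/
theorem smooth_fiberToSpecResidueField_genericPoint_comp_snd [IsIntegral Y] [IsIntegral Y']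
    [IsDominant ψ] (hf : Smooth (f.fiberToSpecResidueField (genericPoint Y))) :
    Smooth ((ι ≫ pullback.snd f ψ).fiberToSpecResidueField (genericPoint Y')) := by
  have hη : ψ (genericPoint Y') = genericPoint Y := genericPoint_eq_of_isDominant ψ
  have Hf := isPullback_fiberToSpecResidueField_of_isPullback (IsPullback.of_hasPullback f ψ)
    (genericPoint Y')
  have hsm : ∀ y, y = genericPoint Y → Smooth (f.fiberToSpecResidueField y) := by
    rintro _ rfl
    exact hf
  have h1 : Smooth ((pullback.snd f ψ).fiberToSpecResidueField (genericPoint Y')) :=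
    MorphismProperty.of_isPullback (P := @Smooth) Hf (hsm _ hη)
  haveI : IsReduced (pullback (pullback.snd f ψ) (Y'.fromSpecResidueField (genericPoint Y'))) :=
    @isReduced_of_smooth _ _ _ ((pullback.snd f ψ).fiberToSpecResidueField (genericPoint Y')) h1
  obtain ⟨c, hc, hcs, hcsnd, -⟩ :=
    exists_fibreComparison f ψ ι (Y'.fromSpecResidueField (genericPoint Y'))
  haveI := hc
  haveI := hcs inferInstance
  haveI : IsIso c := isIso_of_isClosedImmersion_of_surjective c
  have hc' : Smooth (c ≫ (pullback.snd f ψ).fiberToSpecResidueField (genericPoint Y')) :=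
    MorphismProperty.comp_mem _ _ _ (inferInstance : Smooth c) h1
  have e : (ι ≫ pullback.snd f ψ).fiberToSpecResidueField (genericPoint Y') =
      c ≫ (pullback.snd f ψ).fiberToSpecResidueField (genericPoint Y') := hcsnd.symm
  rw [e]
  exact hc'
/-! ## Irreducibility of `X'` ("from this we conclude that `X'` is irreducible") -/

/-- **A scheme with irreducible generic fibre in which the smooth locus is dense in every fibre is
irreducible** — the argument behind de Jong 1996, 4.15 "the morphism `f'` satisfies (vi) a)–c);
from this we conclude that `X'` is irreducible": the smooth locus `U = sm(X'/Y')` is dense in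
`X'` (it is dense in every fibre); `U → Y'` is smooth, hence open, so every non-empty open of `U`
meets the generic fibre, which is irreducible; hence any two non-empty opens of `U` meet inside
the generic fibre, `U` is irreducible, and so is its closure `X'`. [cite: DeJong1996, 4.15, p. 71] -/
theorem irreducibleSpace_of_dense_smoothLocus {X' Y' : Scheme.{u}} (f' : X' ⟶ Y')
    [LocallyOfFinitePresentation f'] [IrreducibleSpace Y'] [Nonempty X']
    [IrreducibleSpace ↥(f'.fiber (genericPoint Y'))]
    (hb : ∀ y : Y', Dense ((f'.fiberι y) ⁻¹' (f'.smoothLocus : Set X'))) :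
    IrreducibleSpace X' := by
  set U : X'.Opens := f'.smoothLocus with hU
  -- `U` is dense in `X'`
  have hUdense : Dense (U : Set X') := by
    rw [dense_iff_inter_open]
    rintro V hV ⟨x, hxV⟩
    have hVy : IsOpen ((f'.fiberι (f' x)) ⁻¹' V) := hV.preimage (f'.fiberι (f' x)).continuous
    obtain ⟨z, hzV, hzU⟩ := (hb (f' x)).inter_open_nonempty _ hVy
      ⟨f'.asFiber x, show f'.fiberι _ (f'.asFiber x) ∈ V by rwa [Scheme.Hom.fiberι_asFiber]⟩
    exact ⟨_, hzV, hzU⟩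
  -- `U → Y'` is open
  have hsmU : Smooth (U.ι ≫ f') := by
    rw [← Scheme.Hom.smoothLocus_eq_top_iff, ← Scheme.Hom.preimage_smoothLocus_eq]
    exact top_le_iff.mp fun x _ => x.2
  have hopen : IsOpenMap (U.ι ≫ f') := Scheme.Hom.isOpenMap _
  -- every non-empty open piece of `U` has a point over the generic point of `Y'`
  have key : ∀ V : Set X', IsOpen V → ((U : Set X') ∩ V).Nonempty →
      ∃ a : ↥(f'.fiber (genericPoint Y')), f'.fiberι _ a ∈ (U : Set X') ∩ V := by
    intro V hV ⟨x, hxU, hxV⟩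
    have ho : IsOpen ((U.ι ≫ f') '' (U.ι ⁻¹' V)) := hopen _ (hV.preimage U.ι.continuous)
    have hne : ((U.ι ≫ f') '' (U.ι ⁻¹' V)).Nonempty := ⟨_, ⟨⟨x, hxU⟩, hxV, rfl⟩⟩
    have hη : genericPoint Y' ∈ (U.ι ≫ f') '' (U.ι ⁻¹' V) :=
      ((genericPoint_spec Y').mem_open_set_iff ho).mpr (by rwa [Set.univ_inter])
    obtain ⟨⟨a, haU⟩, haV, ha⟩ := hη
    have ha' : a ∈ f' ⁻¹' {genericPoint Y'} := by
      show f' a = genericPoint Y'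
      rw [← ha]
      rfl
    rw [← Scheme.Hom.range_fiberι] at ha'
    obtain ⟨a', rfl⟩ := ha'
    exact ⟨a', haU, haV⟩
  -- `U` is irreducible
  have hUirr : IsPreirreducible (U : Set X') := by
    intro u v hu hv huU hvU
    obtain ⟨a, haU, hau⟩ := key u hu huU
    obtain ⟨b, hbU, hbv⟩ := key v hv hvU
    have hu' : IsOpen ((f'.fiberι (genericPoint Y')) ⁻¹' ((U : Set X') ∩ u)) :=
      (U.isOpen.inter hu).preimage (f'.fiberι _).continuous
    have hv' : IsOpen ((f'.fiberι (genericPoint Y')) ⁻¹' ((U : Set X') ∩ v)) :=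
      (U.isOpen.inter hv).preimage (f'.fiberι _).continuous
    obtain ⟨c, -, ⟨hcU, hcu⟩, ⟨-, hcv⟩⟩ :=
      (IrreducibleSpace.isIrreducible_univ ↥(f'.fiber (genericPoint Y'))).isPreirreducible _ _
        hu' hv' ⟨a, trivial, haU, hau⟩ ⟨b, trivial, hbU, hbv⟩
    exact ⟨_, hcU, hcu, hcv⟩
  -- hence so is `X' = closure U`
  have huniv : IsPreirreducible (Set.univ : Set X') := by
    rw [← hUdense.closure_eq]
    exact hUirr.closure
  haveI : PreirreducibleSpace X' := ⟨huniv⟩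
  exact ⟨inferInstance⟩

end DeJong1996.StrictTransform

end Literature.AlgebraicGeometry.Resolution

end
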